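import Literature.Geometry.Kaehler.MayerVietoris
import Literature.Geometry.Kaehler.ChartTransport

/-!
# SmoothPoincare4 / SullivanDual — crux `Target` (stmt-SmoothPoincare4-7823), stub `helper_localClosedForms_one_union_le_of_isPreconnected`

The Mayer–Vietoris vanishing criterion in degree one for the local de Rham cohomology of open
subsets of a manifold (`Literature.Geometry.Kaehler.LocalForms`): for open `P`, `Q`,

  `H¹(P) = 0`, `H¹(Q) = 0`, `P ∩ Q` connected  ⟹  `H¹(P ∪ Q) = 0`,

phrased as inclusions `localClosedForms ≤ localExactForms`.

Proof.  Let `θ` be a closed `1`-form on `P ∪ Q`.  By hypothesis `θ|_P = d a` and `θ|_Q = d b`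
for `0`-forms `a` on `P` and `b` on `Q`.  On `P ∩ Q` the `0`-form `a - b` is closed, hence
locally constant (closed `0`-forms on a chart ball are constant in the chart,
`inChart_apply_eq_of_mem_localClosedForms_zero`), hence constant (`= v`) since `P ∩ Q` is
preconnected.  The constant `0`-form `v` is smooth with `d v = 0`, so `b + v` is another primitive
of `θ` on `Q`, which now agrees with `a` on `P ∩ Q`; gluing `a` and `b + v` (`MForm.glue`) gives a
`0`-form on `P ∪ Q` whose differential is `θ`.  (This is the exactness of the Mayer–Vietoris
sequence `H⁰(P) ⊕ H⁰(Q) → H⁰(P ∩ Q) → H¹(P ∪ Q) → H¹(P) ⊕ H¹(Q)` combined with the surjectivity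
of the first arrow onto the constants for connected `P ∩ Q`.)

References: R. Bott, L. W. Tu, *Differential Forms in Algebraic Topology* (1982), §I.2,
Prop. 2.3 [BottTu1982Forms]; J. M. Lee, *Introduction to Smooth Manifolds* (2013), Prop. 17.6.
-/

noncomputable section

-- the registered namespace `Summit.SmoothPoincare4.SmoothPoincare4.Theorems` repeats a component
set_option linter.dupNamespace false

open scoped Manifold ContDiff Topology
open Set Filter
open Literature.Geometry.Kaehler

namespace Summit.SmoothPoincare4.SmoothPoincare4.Theorems

namespace SullivanDual

variable {E : Type*} [NormedAddCommGroup E] [NormedSpace ℝ E]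
  {H : Type*} [TopologicalSpace H] {I : ModelWithCorners ℝ E H}
  {M : Type*} [TopologicalSpace M] [ChartedSpace H M]
  {F : Type*} [NormedAddCommGroup F] [NormedSpace ℝ F]

/-- A `0`-form takes equal values (on the empty tuple) at equal points — dependent-type
bookkeeping to compare `α x` and `α y` for `x = y`. [folklore] -/
private theorem apply_zero_eq_of_eq' (α : MForm I M F 0) {x₁ x₂ : M} (h : x₁ = x₂)
    (w₁ : Fin 0 → TangentSpace I x₁) (w₂ : Fin 0 → TangentSpace I x₂) : α x₁ w₁ = α x₂ w₂ := by
  subst h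
  rw [Subsingleton.elim w₁ w₂]

/-- **Closed `0`-forms are locally constant**: a closed `0`-form on an open set `U` takes, near
each point `x ∈ U`, the value it takes at `x` (closed `0`-forms on a chart ball inside `U` are
constant in the chart; Lee (2013), Prop. 17.6). [folklore] -/
private theorem eventually_apply_eq_of_mem_localClosedForms_zero [IsManifold I ∞ M]
    [I.Boundaryless] {U : Set M} (hU : IsOpen U) {γ : MForm I M F 0}
    (hγ : γ ∈ localClosedForms I F 0 U) {x : M} (hx : x ∈ U) :
    ∀ᶠ z in 𝓝 x, γ z Fin.elim0 = γ x Fin.elim0 := by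
  -- an open chart ball around `x` inside `U`
  have hWo : IsOpen ((extChartAt I x).target ∩ (extChartAt I x).symm ⁻¹' U) :=
    (continuousOn_extChartAt_symm x).isOpen_inter_preimage (isOpen_extChartAt_target x) hU
  have hxW : extChartAt I x x ∈ (extChartAt I x).target ∩ (extChartAt I x).symm ⁻¹' U :=
    ⟨mem_extChartAt_target x, by rw [mem_preimage, extChartAt_to_inv]; exact hx⟩
  obtain ⟨δ, hδ, hball⟩ := Metric.isOpen_iff.1 hWo _ hxW
  have hCT : Metric.ball (extChartAt I x x) δ ⊆ (extChartAt I x).target := fun y hy ↦ (hball hy).1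
  have hCU : chartSet I x (Metric.ball (extChartAt I x x) δ) ⊆ U := fun z hz ↦ by
    have h := (hball hz.2).2
    rw [mem_preimage, (extChartAt I x).left_inv hz.1] at h
    exact h
  have hCo : IsOpen (chartSet I x (Metric.ball (extChartAt I x x) δ)) :=
    isOpen_chartSet I x Metric.isOpen_ball
  have hxC : x ∈ chartSet I x (Metric.ball (extChartAt I x x) δ) :=
    ⟨mem_extChartAt_source x, Metric.mem_ball_self hδ⟩
  have hγC := restr_mem_localClosedForms hCo hCU hγ
  filter_upwards [hCo.mem_nhds hxC] with z hz
  -- constancy of the representative on the ball, read at the two chart points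
  have key := inChart_apply_eq_of_mem_localClosedForms_zero x Metric.isOpen_ball
    (convex_ball _ _) hCT hγC (Metric.mem_ball_self hδ) hz.2
  have ex : γ.restr (chartSet I x (Metric.ball (extChartAt I x x) δ)) z Fin.elim0 =
      γ.restr (chartSet I x (Metric.ball (extChartAt I x x) δ)) x Fin.elim0 := by
    have h := congrArg (fun φ : E [⋀^Fin 0]→L[ℝ] F ↦ φ Fin.elim0) key
    simp only [MForm.inChart_apply] at h
    rw [apply_zero_eq_of_eq' _ ((extChartAt I x).left_inv hz.1).symm Fin.elim0 _,
      apply_zero_eq_of_eq' _ ((extChartAt I x).left_inv (mem_extChartAt_source x)).symm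
        Fin.elim0 _]
    exact h
  rwa [MForm.restr_apply_of_mem _ hz, MForm.restr_apply_of_mem _ hxC] at ex

/-- **Closed `0`-forms on a preconnected open set are constant** (locally constant functions on
a preconnected space are constant). [folklore] -/
private theorem apply_eq_of_mem_localClosedForms_zero_of_isPreconnected [IsManifold I ∞ M]
    [I.Boundaryless] {U : Set M} (hU : IsOpen U) (hUc : IsPreconnected U) {γ : MForm I M F 0}
    (hγ : γ ∈ localClosedForms I F 0 U) {x y : M} (hx : x ∈ U) (hy : y ∈ U) :
    γ x Fin.elim0 = γ y Fin.elim0 := by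
  haveI : PreconnectedSpace U := isPreconnected_iff_preconnectedSpace.1 hUc
  have hf : IsLocallyConstant (fun z : U ↦ γ (z : M) Fin.elim0) := by
    refine (IsLocallyConstant.iff_eventually_eq _).2 fun z ↦ ?_
    exact (continuous_subtype_val.tendsto z).eventually
      (eventually_apply_eq_of_mem_localClosedForms_zero hU hγ z.2)
  exact hf.apply_eq_of_preconnectedSpace ⟨x, hx⟩ ⟨y, hy⟩

/-- The chart representative of a constant `0`-form is constant. [folklore] -/
private theorem inChart_of_apply_eq_const {κ : MForm I M F 0} {v : F}
    (hκ : ∀ (x : M) (w : Fin 0 → TangentSpace I x), κ x w = v) (x₀ : M) :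
    κ.inChart x₀ = fun _ ↦ ContinuousAlternatingMap.constOfIsEmpty ℝ E (Fin 0) v := by
  funext y
  ext w
  rw [MForm.inChart_apply, hκ, ContinuousAlternatingMap.constOfIsEmpty_apply]

/-- A constant `0`-form is smooth at every point. [folklore] -/
private theorem smoothAt_of_apply_eq_const {κ : MForm I M F 0} {v : F}
    (hκ : ∀ (x : M) (w : Fin 0 → TangentSpace I x), κ x w = v) (x : M) : κ.SmoothAt x := by
  rw [MForm.SmoothAt, inChart_of_apply_eq_const hκ]
  exact contDiffWithinAt_const

/-- A constant `0`-form is closed: `d v = 0` (in the chart, `fderivWithin` of a constant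
vanishes). [folklore] -/
private theorem mextDeriv_of_apply_eq_const [IsManifold I ∞ M] {κ : MForm I M F 0} {v : F}
    (hκ : ∀ (x : M) (w : Fin 0 → TangentSpace I x), κ x w = v) (x : M) : mextDeriv κ x = 0 := by
  have h : extDerivWithin (fun _ : E ↦ ContinuousAlternatingMap.constOfIsEmpty ℝ E (Fin 0) v)
      (range I) (extChartAt I x x) = 0 := by
    rw [extDerivWithin, fderivWithin_const_apply,
      ← ContinuousAlternatingMap.alternatizeUncurryFinCLM_apply, map_zero]
  rw [mextDeriv_eq_extDerivWithin, inChart_of_apply_eq_const hκ, h]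
  rfl

/-- **Mayer–Vietoris vanishing criterion in degree one.**  For open subsets `P`, `Q` of a
boundaryless `C^∞` manifold: if every closed `1`-form on `P` and on `Q` is exact and `P ∩ Q` is
preconnected, then every closed `1`-form on `P ∪ Q` is exact (`H¹(P) = H¹(Q) = 0` and `P ∩ Q`
connected imply `H¹(P ∪ Q) = 0`: the difference of the two primitives is a closed `0`-form on
`P ∩ Q`, hence a constant, and correcting one primitive by that constant the two glue).
Bott–Tu (1982), Prop. 2.3 (Mayer–Vietoris sequence) with Lee (2013), Prop. 17.6 (closed
`0`-forms on connected sets are constant). [cite: BottTu1982Forms, Prop. 2.3] -/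
theorem helper_localClosedForms_one_union_le_of_isPreconnected
    {E : Type*} [NormedAddCommGroup E] [NormedSpace ℝ E] [FiniteDimensional ℝ E]
    {H : Type*} [TopologicalSpace H] {I : ModelWithCorners ℝ E H} [I.Boundaryless]
    {M : Type*} [TopologicalSpace M] [ChartedSpace H M] [IsManifold I ∞ M] [T2Space M]
    [SecondCountableTopology M]
    {F : Type*} [NormedAddCommGroup F] [NormedSpace ℝ F]
    {P Q : Set M} (hP : IsOpen P) (hQ : IsOpen Q)
    (hPe : localClosedForms I F 1 P ≤ localExactForms I F hP 1)
    (hQe : localClosedForms I F 1 Q ≤ localExactForms I F hQ 1)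
    (hPQ : IsPreconnected (P ∩ Q)) :
    localClosedForms I F 1 (P ∪ Q) ≤ localExactForms I F (hP.union hQ) 1 := by
  intro θ hθ
  -- primitives on `P` and on `Q`
  obtain ⟨a, ha⟩ := (mem_localExactForms_succ_iff hP).1
    (hPe (restr_mem_localClosedForms hP subset_union_left hθ))
  obtain ⟨bb, hb⟩ := (mem_localExactForms_succ_iff hQ).1
    (hQe (restr_mem_localClosedForms hQ subset_union_right hθ))
  have hda : ∀ y ∈ P, mextDeriv (a : MForm I M F 0) y = θ y := fun y hy ↦ by
    rw [← localD_apply_of_mem hP a hy, ha, MForm.restr_apply_of_mem _ hy]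
  have hdb : ∀ y ∈ Q, mextDeriv (bb : MForm I M F 0) y = θ y := fun y hy ↦ by
    rw [← localD_apply_of_mem hQ bb hy, hb, MForm.restr_apply_of_mem _ hy]
  -- the closed `0`-form `a - b` on `P ∩ Q`
  have hγ : ((a : MForm I M F 0) - bb).restr (P ∩ Q) ∈ localClosedForms I F 0 (P ∩ Q) := by
    refine ⟨⟨fun y hy ↦ (MForm.smoothAt_restr_iff (hP.inter hQ) _ hy).2
        ((a.2.1 y hy.1).sub (bb.2.1 y hy.2)), fun y hy ↦ MForm.restr_apply_of_notMem _ hy⟩,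
      fun y hy ↦ ?_⟩
    rw [mextDeriv_restr_apply (hP.inter hQ) _ hy, mextDeriv_sub_apply (a.2.1 y hy.1) (bb.2.1 y hy.2),
      hda y hy.1, hdb y hy.2, sub_self]
  -- it is constant, with value `v`
  obtain ⟨v, hv⟩ : ∃ v : F, ∀ y ∈ P ∩ Q,
      (a : MForm I M F 0) y Fin.elim0 - (bb : MForm I M F 0) y Fin.elim0 = v := by
    rcases (P ∩ Q).eq_empty_or_nonempty with hPQe | ⟨x₀, hx₀⟩
    · exact ⟨0, fun y hy ↦ absurd hy (by rw [hPQe]; exact notMem_empty y)⟩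
    · refine ⟨((a : MForm I M F 0) - bb).restr (P ∩ Q) x₀ Fin.elim0, fun y hy ↦ ?_⟩
      rw [← apply_eq_of_mem_localClosedForms_zero_of_isPreconnected (hP.inter hQ) hPQ hγ hy hx₀,
        MForm.restr_apply_of_mem _ hy]
      rfl
  -- the constant `0`-form `κ ≡ v` and the corrected primitive `w = b + κ|_Q` on `Q`
  set κ : MForm I M F 0 := fun _ ↦ ContinuousAlternatingMap.constOfIsEmpty ℝ E (Fin 0) v with hκ
  have hκv : ∀ (x : M) (u : Fin 0 → TangentSpace I x), κ x u = v := fun _ _ ↦ rfl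
  have hκQ : κ.restr Q ∈ smoothFormsOn I F Q 0 :=
    ⟨fun y hy ↦ (MForm.smoothAt_restr_iff hQ _ hy).2 (smoothAt_of_apply_eq_const hκv y),
      fun y hy ↦ MForm.restr_apply_of_notMem _ hy⟩
  set w : MForm I M F 0 := (bb : MForm I M F 0) + κ.restr Q with hw
  have hwm : w ∈ smoothFormsOn I F Q 0 := add_mem bb.2 hκQ
  have hdw : ∀ y ∈ Q, mextDeriv w y = θ y := fun y hy ↦ by
    rw [hw, mextDeriv_add_apply (bb.2.1 y hy) (hκQ.1 y hy), hdb y hy, mextDeriv_restr_apply hQ _ hy,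
      mextDeriv_of_apply_eq_const hκv y, add_zero]
  -- `a` and `w` agree on `P ∩ Q`
  have huv : ∀ y ∈ P ∩ Q, (a : MForm I M F 0) y = w y := by
    intro y hy
    rw [hw, Pi.add_apply, MForm.restr_apply_of_mem _ hy.2]
    ext u
    rw [ContinuousAlternatingMap.add_apply, hκv, ← hv y hy, Subsingleton.elim u Fin.elim0,
      add_sub_cancel]
  -- glue
  set cc : smoothFormsOn I F (P ∪ Q) 0 :=
    ⟨MForm.glue P Q (a : MForm I M F 0) w, glue_mem_smoothFormsOn hP hQ a.2 hwm huv⟩ with hcc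
  refine (mem_localExactForms_succ_iff (hP.union hQ)).2 ⟨cc, funext fun x ↦ ?_⟩
  by_cases hxP : x ∈ P
  · rw [localD_apply_of_mem _ _ (mem_union_left Q hxP)]
    change mextDeriv (MForm.glue P Q (a : MForm I M F 0) w) x = _
    rw [mextDeriv_glue_of_mem_left hP _ w hxP, hda x hxP]
  · by_cases hxQ : x ∈ Q
    · rw [localD_apply_of_mem _ _ (mem_union_right P hxQ)]
      change mextDeriv (MForm.glue P Q (a : MForm I M F 0) w) x = _
      rw [mextDeriv_glue_of_mem_right hQ huv hxQ, hdw x hxQ]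
    · have h : x ∉ P ∪ Q := fun h ↦ h.elim hxP hxQ
      rw [coe_localD, MForm.restr_apply_of_notMem _ h, hθ.1.2 x h]

end SullivanDual

end Summit.SmoothPoincare4.SmoothPoincare4.Theorems

end
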